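import Literature.NumberTheory.Transcendental.ManyCurvePeriodsIsotypicProofs
import Literature.NumberTheory.Transcendental.ManyCurveThetaClassification
import HarnessLib

/-!
# The isotypic splitting of elliptic periods — the named fact `HuberWustholzIsotypicSplitting` DISCHARGED

Topic `Literature/NumberTheory/Transcendental`; a proofs-only companion (one theorem: no
definitions, no named facts) of `ManyCurvePeriodsIsotypic.lean`, whose named fact
`HuberWustholzIsotypicSplitting` (A. Huber, G. Wüstholz, *Transcendence and Linear Relations of
1-Periods*, Cambridge Tracts in Mathematics 227, CUP 2022, **Theorem 15.3 (1), (3)** (p. 145) for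
the 1-motive `M = [ℤ →⁰ 𝔾ₘ] × E₁ × ⋯ × E_k` with ARBITRARY elliptic curves `Eⱼ/ℚ̄` — CM and
isogenies allowed —, read with the isotypical decomposition of §15.2.2 (Lemma 15.8 / Prop. 15.9,
pp. 149–150) and p. 193: a vanishing `ℚ̄`-combination of `1, 2πi` and the `ω₁, ω₂, η₁, η₂` of the
`Eⱼ` has vanishing `1`- and `2πi`-coefficients and vanishing ISOGENY-CLASS blocks) is proved here
outright.

The proof is the composition of two theorems of the tree:

* `HuberWustholzIsotypicSplitting_of_manyCurvePeriods`
  (`ManyCurvePeriodsIsotypicProofs.lean`): the printed reduction of arbitrary factors to PAIRWISE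
  NON-ISOGENOUS representatives by isogeny transport of periods (Baker–Wüstholz 2007, §6.2 p. 95
  and p. 98; Huber–Wüstholz §15.2.2), proved sorry-free from the sibling named fact
  `HuberWustholzManyCurvePeriods`;
* `HuberWustholzManyCurvePeriods_holds` (`ManyCurveThetaClassification.lean`): that sibling —
  Thm. 15.3 (1) for pairwise non-isogenous curves, CM allowed — is a theorem of the tree
  (reduction to the Baker–Wüstholz analytic subgroup theorem for the `k`-lattice standard models
  of `𝔾ₐ × 𝔾ₘ^ι × ∏ E♮` at torsion points and Philippon's zero estimate for their theta models,
  the `ManyCurve*` files).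

By `HuberWustholzIsotypicSplitting_iff_manyCurvePeriods` the two named facts are equivalent, so
nothing is lost in this route. This file is a leaf: `ManyCurvePeriodsIsotypic(Proofs).lean` keep
their light imports, and users of `(h : HuberWustholzIsotypicSplitting)` are fed
`HuberWustholzIsotypicSplitting_holds` from here.

## References

* A. Huber, G. Wüstholz, *Transcendence and Linear Relations of 1-Periods*, Cambridge Tracts in
  Mathematics 227, CUP 2022 [HuberWustholz2022]: Thm. 15.3 (1), (3) (p. 145); §15.2.2,
  Lemma 15.8 / Prop. 15.9 (pp. 149–150); Prop. 16.5 (2); Prop. 18.8 / Summary 18.1; p. 193.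
* A. Baker, G. Wüstholz, *Logarithmic Forms and Diophantine Geometry*, New Mathematical
  Monographs 9, CUP 2007 [BakerWustholz2007]: §6.2 (p. 95), Thm. 6.4 (p. 98), Thm. 6.15.
* P. Philippon, *Lemmes de zéros dans les groupes algébriques commutatifs*, Bull. Soc. Math.
  France 114 (1986), 355–383, Thm. 2.1. [Philippon1986]
-/

noncomputable section

namespace Literature.NumberTheory.Transcendental

/-- **DISCHARGE of the named fact `HuberWustholzIsotypicSplitting`** (Huber–Wüstholz, Cambridge
Tract 227, Thm. 15.3 (1), (3) for `M = [ℤ →⁰ 𝔾ₘ] × E₁ × ⋯ × E_k`, arbitrary `Eⱼ/ℚ̄`: a vanishing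
`ℚ̄`-combination of `1, 2πi, ω₁⁽ʲ⁾, ω₂⁽ʲ⁾, η₁⁽ʲ⁾, η₂⁽ʲ⁾` has `α = β = 0` and vanishing isogeny-class
blocks): the printed reduction to pairwise non-isogenous representatives
(`HuberWustholzIsotypicSplitting_of_manyCurvePeriods`) applied to the proved `k`-curve theorem
`HuberWustholzManyCurvePeriods_holds`.
[cite: HuberWustholz2022, Thm. 15.3 (1), (3) (p. 145) with §15.2.2 Lemma 15.8 / Prop. 15.9 (pp. 149–150) and p. 193] -/
theorem HuberWustholzIsotypicSplitting_holds : HuberWustholzIsotypicSplitting :=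
  HuberWustholzIsotypicSplitting_of_manyCurvePeriods HuberWustholzManyCurvePeriods_holds

end Literature.NumberTheory.Transcendental

end
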